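import Literature.NumberTheory.LFunctions.ThetaChainSound
import Literature.NumberTheory.LFunctions.RosserSchoenfeldMertensChainSound
import HarnessLib

/-!
# Khale 2024, Appendix A on a finite range by kernel computation: the checker and its soundness

Topic `Literature/NumberTheory/LFunctions`.  T. Khale, *An explicit Vinogradov–Korobov zero-free
region for Dirichlet L-functions*, arXiv:2210.06457v1, **Corollary A.2**: for `q ≥ 3`,
`Σ_{(n,q)>1} Λ(n)/n < log log q + 0.66` ("for `3 ≤ q ≤ 2310`, the statement can be verified by
computer"; Lemma A.1 handles `q ≥ 2310` through Rosser–Schoenfeld's (3.22), which the tree does not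
have).  Since `Σ_{(n,q)>1} Λ(n)/n = Σ_{p∣q} log p/(p−1)` and both sides are monotone in the obvious
way, the corollary reduces (see `KhaleAppendixA.lean`) to the inequality at the primorials, i.e. to

  **(A)**  `F(P) := Σ_{p ≤ P} log p/(p − 1) < log θ(P) + 0.66`  for every prime `P ≥ 3`

(`θ` = Chebyshev's function), which is tight only at `P = 3` (margin `7.4·10⁻⁴`) and is proved
analytically for `P > 10⁶` in `KhaleAppendixA.lean`.  This file is the *computable core* of a kernel
certificate of (A) for the primes `P ≤ 10⁶`, in the style of the tree's `θ`-chain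
(`ThetaChainCheck.lean`/`ThetaChainSound.lean`, whose table `ChainTable.table`, primality test
`ThetaChain.primeChk` and certified fixed-point logarithms `ChainCheck.lnp`/`ChainCheck.logN` it
reuses), together with its semantic soundness.  Nothing is asserted beyond what is proved; the run
itself is `KhaleAppendixARun.lean`.

## The state, one step, the invariant

A state `⟨p, Llo, Lhi, Fhi, Chi, Tlo, Thi, Glo⟩` records the last prime `p` reached with natural
fixed-point (`2⁸⁰`) enclosures `Llo ≤ 2⁸⁰ log p ≤ Lhi`, `2⁸⁰ F(p) ≤ Fhi`,
`2⁸⁰ C(p) ≤ Chi` (`C(P) = Σ_{p≤P} log p/(p(p−1))`, needed by the analytic range),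
`Tlo ≤ 2⁸⁰ θ(p) ≤ Thi`, `Glo ≤ 2⁸⁰ (log θ(p) + 1)`.  A step to the next table entry `p'` checks
`p < p'`, `p'` odd and prime (`primeChk`), extends the enclosures (`ThetaChain.logNext`;
`log θ(p') = log θ(p) + log(1 + log p'/θ(p)) ≥ log θ(p) + log(1 + Llo'/Thi)` by `ChainCheck.lnp`
when `2 Llo' ≤ Thi`, else `log θ(p') ≥ log Tlo' − 80 log 2` by `ChainCheck.logN`), and performs the
comparison `Fhi' + 2⁸⁰ < Glo' + ⌊0.66·2⁸⁰⌋`, which is (A) at `p'` (`step_inv`).  The invariant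
`Inv` carries (A) for all primes `3 ≤ r ≤ p`; `run`/`runD` iterate along the table cursor
(`run_sound`), `initS_inv` starts it at `p = 2`, and `finalChk` (`p ≥ 10⁶`, `Chi ≤ ⌊0.7555·2⁸⁰⌋`)
exports `C(p) ≤ 0.7555` (`C_le_of_finalChk`).

## References

* T. Khale, arXiv:2210.06457v1, Appendix A (Lemma A.1, Corollary A.2). [Khale2024]
* J. B. Rosser, L. Schoenfeld, Illinois J. Math. 6 (1962), 64–94, (2.11) (`Σ_p log p/(p(p−1))`
  `= −γ − E = 0.75536…`). [RosserSchoenfeld1962]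
-/

noncomputable section

namespace Literature.NumberTheory.LFunctions.KhaleChain

open ChainCheck ChainTable ThetaChain MertensChain Real Finset
open scoped Chebyshev

/-! ## Part 1: the computable checker -/

/-- `⌊0.66 · 2⁸⁰⌋`. [folklore] -/
def C66 : ℕ := 797891040945655255306076

/-- `⌊0.7555 · 2⁸⁰⌋`. [folklore] -/
def CMAX : ℕ := 913343456718852341490515

/-- A state of the Appendix-A chain. [folklore] -/
structure AS where
  /-- the last prime reached -/
  p : ℕ
  /-- lower bound of `2⁸⁰ log p` -/
  Llo : ℕ
  /-- upper bound of `2⁸⁰ log p` -/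
  Lhi : ℕ
  /-- upper bound of `2⁸⁰ F(p)`, `F(p) = Σ_{r ≤ p} log r/(r − 1)` -/
  Fhi : ℕ
  /-- upper bound of `2⁸⁰ C(p)`, `C(p) = Σ_{r ≤ p} log r/(r(r − 1))` -/
  Chi : ℕ
  /-- lower bound of `2⁸⁰ θ(p)` -/
  Tlo : ℕ
  /-- upper bound of `2⁸⁰ θ(p)` -/
  Thi : ℕ
  /-- lower bound of `2⁸⁰ (log θ(p) + 1)` -/
  Glo : ℕ
  deriving Repr, DecidableEq

/-- Lower bound of `2⁸⁰ (log θ(p') + 1)` from that at `p`: by `ChainCheck.lnp` on `1 + Llo'/Thi` when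
`2 Llo' ≤ Thi`, else from `ChainCheck.logN Tlo'` (`log θ(p') ≥ log Tlo' − 80 log 2`). [folklore] -/
def gloNext (Glo Llo' Tlo' Thi : ℕ) : Option ℕ :=
  bif Nat.ble (Nat.mul 2 Llo') Thi then
    match lnp Llo' Thi with
    | (dlo, _) => some (Nat.add Glo dlo)
  else
    match logN Tlo' with
    | none => none
    | some (lg, _) => some (Nat.sub (Nat.add lg SC) (Nat.mul 80 L2HIN))

/-- **One step** of the chain to the next table entry `p'`: order, parity and primality of `p'`, the
new enclosures, and the comparison `Fhi' + 2⁸⁰ < Glo' + ⌊0.66·2⁸⁰⌋` (inequality (A) at `p'`).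
[cite: Khale2024, Corollary A.2] -/
def step (s : AS) (p' : ℕ) : Option AS :=
  match s with
  | ⟨p, Llo, Lhi, Fhi, Chi, Tlo, Thi, Glo⟩ =>
    bif !(Nat.blt p p' && Nat.beq (Nat.mod p' 2) 1 && primeChk p') then none else
    match logNext p Llo Lhi p' with
    | none => none
    | some (Llo', Lhi') =>
      let Fhi' := Nat.add (Nat.add Fhi (Nat.div Lhi' (Nat.sub p' 1))) 1
      let Chi' := Nat.add (Nat.add Chi (Nat.div Lhi' (Nat.mul p' (Nat.sub p' 1)))) 1
      let Tlo' := Nat.add Tlo Llo'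
      let Thi' := Nat.add Thi Lhi'
      match gloNext Glo Llo' Tlo' Thi with
      | none => none
      | some Glo' =>
        bif Nat.blt (Nat.add Fhi' SC) (Nat.add Glo' C66) then
          some ⟨p', Llo', Lhi', Fhi', Chi', Tlo', Thi', Glo'⟩
        else none

/-- Run over a segment of the table with fuel: stops successfully when the fuel or the segment is
exhausted, fails as soon as a step fails. [folklore] -/
def run : ℕ → AS → List ℕ → Option AS
  | 0, s, _ => some s
  | _ + 1, s, [] => some s
  | fuel + 1, s, p' :: rest =>
    match step s p' with
    | none => none
    | some s' => run fuel s' rest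

/-- The initial state: `p = 2`, `F(2) = log 2`, `C(2) = (log 2)/2`, `θ(2) = log 2`, and the trivial
bound `0 ≤ 2⁸⁰ (log log 2 + 1)`. [folklore] -/
def initS : AS := ⟨2, L2LON, L2HIN, L2HIN, Nat.add (Nat.div L2HIN 2) 1, L2LON, L2HIN, 0⟩

/-- **A chunk of the run**: at most `fuel` entries of `ChainTable.table` after the state's prime.
[folklore] -/
def runD (fuel : ℕ) (s : AS) : Option AS := run fuel s (ChainCheck.after s.p table)

/-- The final test: the prime reached is `≥ 10⁶` and `Chi ≤ ⌊0.7555 · 2⁸⁰⌋`. [folklore] -/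
def finalChk (s : AS) : Bool := Nat.ble 1000000 s.p && Nat.ble s.Chi CMAX

/-! ## Part 2: soundness -/

/-- `F(n) = Σ_{r ≤ n, r prime} log r/(r − 1)`. [cite: Khale2024, Corollary A.2 (proof)] -/
def F (n : ℕ) : ℝ := ∑ r ∈ Nat.primesLE n, Real.log r / ((r : ℝ) - 1)

/-- `C(n) = Σ_{r ≤ n, r prime} log r/(r(r − 1))`. [cite: RosserSchoenfeld1962, (2.11)] -/
def C (n : ℕ) : ℝ := ∑ r ∈ Nat.primesLE n, Real.log r / ((r : ℝ) * ((r : ℝ) - 1))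

/-- `C66 ≤ 0.66 · 2⁸⁰`. [folklore] -/
theorem C66_le : (C66 : ℝ) ≤ 0.66 * 2 ^ 80 := by norm_num [C66]

/-- `CMAX ≤ 0.7555 · 2⁸⁰`. [folklore] -/
theorem CMAX_le : (CMAX : ℝ) ≤ 0.7555 * 2 ^ 80 := by norm_num [CMAX]

/-- `Nat.div a b = a / b` (to normalise the checker's `Nat.div`). [folklore] -/
theorem natDiv_eq (a b : ℕ) : Nat.div a b = a / b := rfl

/-- `(a : ℝ)/b ≤ ⌊a/b⌋ + 1` for naturals, `b > 0`. [folklore] -/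
theorem real_div_le_natDiv_add_one (a : ℕ) {b : ℕ} (hb : 0 < b) :
    (a : ℝ) / b ≤ ((a / b : ℕ) : ℝ) + 1 := by
  have hbR : (0 : ℝ) < b := by exact_mod_cast hb
  rw [div_le_iff₀ hbR]
  have h1 : a < (a / b + 1) * b := by
    rw [Nat.add_mul, one_mul]
    exact Nat.lt_div_mul_add hb
  have h2 : (a : ℝ) < ((a / b : ℕ) + 1 : ℝ) * b := by exact_mod_cast h1
  linarith

/-- `F(2) = log 2`, `C(2) = (log 2)/2`. [folklore] -/
theorem F_two : F 2 = Real.log 2 ∧ C 2 = Real.log 2 / 2 := by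
  have hset : Nat.primesLE 2 = {2} := by decide
  simp only [F, C, hset, Finset.sum_singleton]
  push_cast
  norm_num

/-- `θ(3) = log 2 + log 3 ≥ 1`, hence `θ(r) ≥ 1` and `log θ(r) ≥ 0` for `r ≥ 3`. [folklore] -/
theorem one_le_theta {r : ℕ} (hr : 3 ≤ r) : 1 ≤ θ (r : ℝ) := by
  have h3 : θ ((3 : ℕ) : ℝ) = ∑ p ∈ Nat.primesLE 3, Real.log p := Chebyshev.theta_eq_sum_primesLE_log 3
  have hset : Nat.primesLE 3 = {2, 3} := by decide
  rw [hset, Finset.sum_insert (by decide), Finset.sum_singleton] at h3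
  have hmono : θ ((3 : ℕ) : ℝ) ≤ θ (r : ℝ) := Chebyshev.theta_mono (by exact_mod_cast hr)
  have h6 : Real.log 2 + Real.log 3 = Real.log 6 := by
    rw [← Real.log_mul (by norm_num) (by norm_num)]; norm_num
  have h1 : 1 ≤ Real.log 6 :=
    (Real.le_log_iff_exp_le (by norm_num)).2 (by linarith [Real.exp_one_lt_d9])
  push_cast at h3 hmono
  linarith

/-! ### Soundness of `gloNext` -/

/-- **Soundness of `gloNext`.**  With `Glo ≤ 2⁸⁰ (log θ(p) + 1)`, `Llo' ≤ 2⁸⁰ log p'`,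
`2⁸⁰ θ(p) ≤ Thi`, `Tlo' ≤ 2⁸⁰ θ(p')`, `θ(p') = θ(p) + log p'`, `θ(p) > 0`, `θ(p') ≥ 1`:
`gloNext Glo Llo' Tlo' Thi = some Glo' ⇒ Glo' ≤ 2⁸⁰ (log θ(p') + 1)`. [folklore] -/
theorem gloNext_sound {Glo Llo' Tlo' Thi Glo' : ℕ} {θp θp' lp' : ℝ}
    (h : gloNext Glo Llo' Tlo' Thi = some Glo') (hGlo : (Glo : ℝ) ≤ 2 ^ 80 * (Real.log θp + 1))
    (hLlo' : (Llo' : ℝ) ≤ 2 ^ 80 * lp') (hThi : 2 ^ 80 * θp ≤ Thi) (hTlo' : (Tlo' : ℝ) ≤ 2 ^ 80 * θp')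
    (hθ : θp' = θp + lp') (hθp : 0 < θp) (hθp' : 1 ≤ θp') :
    (Glo' : ℝ) ≤ 2 ^ 80 * (Real.log θp' + 1) := by
  have h80 : (0 : ℝ) < 2 ^ 80 := by positivity
  have hlogθp' : 0 ≤ Real.log θp' := Real.log_nonneg hθp'
  simp only [gloNext, Nat.mul_eq, Nat.add_eq, Nat.sub_eq] at h
  cases hb : Nat.ble (2 * Llo') Thi with
  | true =>
    rw [hb] at h
    simp only [cond_true, Option.some.injEq] at h
    subst h
    have hg : 2 * Llo' ≤ Thi := by simpa [Nat.ble_eq] using hb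
    have hThi0R : (0 : ℝ) < Thi := lt_of_lt_of_le (by positivity) hThi
    have hThi0 : 0 < Thi := by exact_mod_cast hThi0R
    obtain ⟨h1, -⟩ := lnp_sound (p := Llo') hThi0 hg
    -- `log(1 + Llo'/Thi) ≤ log(1 + lp'/θp) = log θp' − log θp`
    have hLlo0 : (0 : ℝ) ≤ Llo' := Nat.cast_nonneg _
    have hlp' : 0 ≤ lp' := by linarith
    have hratio : (Llo' : ℝ) / Thi ≤ lp' / θp := by
      rw [div_le_div_iff₀ hThi0R hθp]
      calc (Llo' : ℝ) * θp ≤ 2 ^ 80 * lp' * θp := mul_le_mul_of_nonneg_right hLlo' hθp.le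
        _ = lp' * (2 ^ 80 * θp) := by ring
        _ ≤ lp' * Thi := mul_le_mul_of_nonneg_left hThi hlp'
    have hlogle : Real.log (1 + (Llo' : ℝ) / Thi) ≤ Real.log θp' - Real.log θp := by
      rw [← Real.log_div (by linarith) hθp.ne']
      refine Real.log_le_log (by positivity) ?_
      rw [le_div_iff₀ hθp, hθ]
      have : (Llo' : ℝ) / Thi * θp ≤ lp' := by
        have := mul_le_mul_of_nonneg_right hratio hθp.le
        rwa [div_mul_cancel₀ _ hθp.ne'] at this
      linarith
    push_cast
    linarith
  | false =>
    rw [hb] at h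
    simp only [cond_false] at h
    rcases hl : logN Tlo' with _ | ⟨lg, hg⟩
    · rw [hl] at h; simp at h
    · rw [hl] at h
      simp only [Option.some.injEq] at h
      subst h
      obtain ⟨hlo, -, hlo0⟩ := logN_sound hl
      -- `Tlo' > 0` as a real, from `0 < lo ≤ 2⁸⁰ log Tlo'`
      have hTpos : (1 : ℝ) < Tlo' := by
        by_contra hle
        push Not at hle
        have : Real.log (Tlo' : ℝ) ≤ 0 := Real.log_nonpos (Nat.cast_nonneg _) hle
        have h0 : (0 : ℝ) < lg := by exact_mod_cast hlo0
        linarith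
      have hlogT : Real.log (Tlo' : ℝ) ≤ 80 * Real.log 2 + Real.log θp' := by
        have h1 : Real.log (Tlo' : ℝ) ≤ Real.log (2 ^ 80 * θp') :=
          Real.log_le_log (by linarith) hTlo'
        rw [Real.log_mul (by positivity) (by linarith), Real.log_pow] at h1
        push_cast at h1
        linarith
      have hL2 := le_L2HIN
      have hreal : ((lg : ℝ) + SC) - 80 * L2HIN ≤ 2 ^ 80 * (Real.log θp' + 1) := by
        rw [SC_real]
        linarith
      -- truncated subtraction
      rcases le_total (80 * L2HIN) (lg + SC) with hle | hle
      · rw [Nat.cast_sub hle]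
        push_cast
        linarith
      · rw [Nat.sub_eq_zero_of_le hle]
        push_cast
        exact mul_nonneg (by positivity) (by linarith)

/-! ### The invariant -/

/-- **The invariant** of a state (relative to `ChainTable.table`). [folklore] -/
structure Inv (s : AS) : Prop where
  /-- the prime reached is a table entry -/
  mem : s.p ∈ table
  /-- and is prime -/
  prime : s.p.Prime
  /-- `Llo ≤ 2⁸⁰ log p` -/
  Llo_le : (s.Llo : ℝ) ≤ 2 ^ 80 * Real.log s.p
  /-- `2⁸⁰ log p ≤ Lhi` -/
  le_Lhi : 2 ^ 80 * Real.log s.p ≤ s.Lhi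
  /-- `2⁸⁰ F(p) ≤ Fhi` -/
  F_le : 2 ^ 80 * F s.p ≤ s.Fhi
  /-- `2⁸⁰ C(p) ≤ Chi` -/
  C_le : 2 ^ 80 * C s.p ≤ s.Chi
  /-- `Tlo ≤ 2⁸⁰ θ(p)` -/
  Tlo_le : (s.Tlo : ℝ) ≤ 2 ^ 80 * θ (s.p : ℝ)
  /-- `2⁸⁰ θ(p) ≤ Thi` -/
  le_Thi : 2 ^ 80 * θ (s.p : ℝ) ≤ s.Thi
  /-- `Glo ≤ 2⁸⁰ (log θ(p) + 1)` -/
  Glo_le : (s.Glo : ℝ) ≤ 2 ^ 80 * (Real.log (θ (s.p : ℝ)) + 1)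
  /-- inequality (A) at every prime `3 ≤ r ≤ p` -/
  claim : ∀ r : ℕ, r.Prime → 3 ≤ r → r ≤ s.p → F r < Real.log (θ (r : ℝ)) + 0.66

/-! ### One step -/

/-- **Soundness of one step.** If `Inv s` holds, `p'` is the table successor of `s.p`, and
`step s p' = some s'`, then `Inv s'` and `s'.p = p'`. [cite: Khale2024, Corollary A.2] -/
theorem step_inv {s s' : AS} (hI : Inv s) {p' : ℕ} {rest : List ℕ}
    (hafter : after s.p table = p' :: rest) (h : step s p' = some s') : Inv s' ∧ s'.p = p' := by
  have hT := tableOK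
  obtain ⟨p, Llo, Lhi, Fhi, Chi, Tlo, Thi, Glo⟩ := s
  simp only at hafter hI
  obtain ⟨hmem, hprime, hLlo, hLhi, hF, hC, hTlo, hThi, hGlo, hclaim⟩ := hI
  simp only at hmem hprime hLlo hLhi hF hC hTlo hThi hGlo hclaim
  -- the successor `p'`
  obtain ⟨hp'T, hpp', hmin⟩ := head_after hT.sorted hafter
  have hp'le : p' ≤ 4599989 := hT.bounded p' hp'T
  have hnoprime : ∀ q : ℕ, p < q → q < p' → ¬ q.Prime := fun q h1 h2 hq =>
    absurd (hmin q (hT.complete q hq (by omega)) h1) (not_le.2 h2)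
  have hp1 : 1 ≤ p := hprime.one_lt.le
  have hp0 : 0 < p := hprime.pos
  have hp2 : 2 ≤ p := hprime.two_le
  -- unfold the step
  simp only [step, Nat.mul_eq, Nat.sub_eq, Nat.add_eq, natDiv_eq] at h
  obtain ⟨hg1, h⟩ := bif_not_none h
  simp only [Bool.and_eq_true] at hg1
  obtain ⟨⟨-, hodd⟩, hchk⟩ := hg1
  have hodd' : Odd p' := Nat.odd_iff.2 (Nat.eq_of_beq_eq_true hodd)
  have hp'prime : p'.Prime := primeChk_sound hchk hodd' (by omega)
  have hp'3 : 3 ≤ p' := by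
    have := hp'prime.two_le
    rcases hodd' with ⟨k, hk⟩
    omega
  rcases hln : logNext p Llo Lhi p' with _ | ⟨Llo', Lhi'⟩
  · rw [hln] at h; simp at h
  · rw [hln] at h
    simp only at h
    rcases hgn : gloNext Glo Llo' (Tlo + Llo') Thi with _ | Glo'
    · rw [hgn] at h; simp at h
    · rw [hgn] at h
      simp only at h
      cases hcmp : Nat.blt (Fhi + Lhi' / (p' - 1) + 1 + SC) (Glo' + C66) with
      | false => rw [hcmp] at h; simp at h
      | true =>
        rw [hcmp] at h
        simp only [cond_true, Option.some.injEq] at h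
        subst h
        -- the new enclosures
        obtain ⟨hLlo', hLhi'⟩ := logNext_sound hln hp0 hpp'.le hLlo hLhi
        have hθ' : θ (p' : ℝ) = θ (p : ℝ) + Real.log p' := theta_succ_prime hp'prime hpp' hnoprime
        have hF' : F p' = F p + Real.log p' / ((p' : ℝ) - 1) :=
          sum_primesLE_succ_prime (fun r : ℕ ↦ Real.log r / ((r : ℝ) - 1)) hp'prime hpp' hnoprime
        have hC' : C p' = C p + Real.log p' / ((p' : ℝ) * ((p' : ℝ) - 1)) :=
          sum_primesLE_succ_prime (fun r : ℕ ↦ Real.log r / ((r : ℝ) * ((r : ℝ) - 1))) hp'prime hpp'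
            hnoprime
        have hp'R : (3 : ℝ) ≤ p' := by exact_mod_cast hp'3
        have hlogp' : 0 ≤ Real.log p' := Real.log_nonneg (by linarith)
        have h80 : (0 : ℝ) < 2 ^ 80 := by positivity
        -- `θ(p) > 0`, `θ(p') ≥ 1`
        have hθp : 0 < θ (p : ℝ) := by
          have h2 : θ ((2 : ℕ) : ℝ) ≤ θ (p : ℝ) := Chebyshev.theta_mono (by exact_mod_cast hp2)
          have : θ ((2 : ℕ) : ℝ) = Real.log 2 := by push_cast; exact theta_two
          rw [this] at h2
          linarith [Real.log_two_gt_d9]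
        have hθp' : 1 ≤ θ (p' : ℝ) := one_le_theta hp'3
        -- `Glo'`
        have hGlo' : (Glo' : ℝ) ≤ 2 ^ 80 * (Real.log (θ (p' : ℝ)) + 1) :=
          gloNext_sound hgn hGlo hLlo' hThi (by push_cast; rw [hθ']; linarith) hθ' hθp hθp'
        -- `Fhi'`, `Chi'`
        have hsub1 : ((p' - 1 : ℕ) : ℝ) = (p' : ℝ) - 1 := by
          rw [Nat.cast_sub (by omega)]; push_cast; ring
        have hFhi' : 2 ^ 80 * F p' ≤ ((Fhi + Lhi' / (p' - 1) + 1 : ℕ) : ℝ) := by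
          rw [hF', mul_add]
          have hd := real_div_le_natDiv_add_one Lhi' (b := p' - 1) (by omega)
          rw [hsub1] at hd
          have hden : (0 : ℝ) < (p' : ℝ) - 1 := by linarith
          have h1 : 2 ^ 80 * (Real.log p' / ((p' : ℝ) - 1)) ≤ (Lhi' : ℝ) / ((p' : ℝ) - 1) := by
            rw [mul_div_assoc', div_le_div_iff_of_pos_right hden]; exact hLhi'
          push_cast
          linarith
        have hChi' : 2 ^ 80 * C p' ≤ ((Chi + Lhi' / (p' * (p' - 1)) + 1 : ℕ) : ℝ) := by
          rw [hC', mul_add]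
          have hd := real_div_le_natDiv_add_one Lhi' (b := p' * (p' - 1))
            (Nat.mul_pos (by omega) (by omega))
          have hsub2 : ((p' * (p' - 1) : ℕ) : ℝ) = (p' : ℝ) * ((p' : ℝ) - 1) := by
            push_cast; rw [hsub1]
          rw [hsub2] at hd
          have hden : (0 : ℝ) < (p' : ℝ) * ((p' : ℝ) - 1) := mul_pos (by linarith) (by linarith)
          have h1 : 2 ^ 80 * (Real.log p' / ((p' : ℝ) * ((p' : ℝ) - 1))) ≤
              (Lhi' : ℝ) / ((p' : ℝ) * ((p' : ℝ) - 1)) := by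
            rw [mul_div_assoc', div_le_div_iff_of_pos_right hden]; exact hLhi'
          push_cast
          linarith
        -- the comparison: (A) at `p'`
        have hA : F p' < Real.log (θ (p' : ℝ)) + 0.66 := by
          have hlt : Fhi + Lhi' / (p' - 1) + 1 + SC < Glo' + C66 := by
            simpa [Nat.blt_eq] using hcmp
          have hltR : ((Fhi + Lhi' / (p' - 1) + 1 : ℕ) : ℝ) + SC < (Glo' : ℝ) + C66 := by
            exact_mod_cast hlt
          rw [SC_real] at hltR
          have hc := C66_le
          linarith
        refine ⟨⟨hp'T, hp'prime, hLlo', hLhi', hFhi', hChi', ?_, ?_, hGlo', ?_⟩, rfl⟩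
        · simp only; rw [hθ']; push_cast; linarith
        · simp only; rw [hθ']; push_cast; linarith
        · intro r hr h3 hrp'
          simp only at hrp'
          rcases lt_or_eq_of_le hrp' with hlt | rfl
          · have hrp : r ≤ p := by
              by_contra hh
              push Not at hh
              exact hnoprime r hh hlt hr
            exact hclaim r hr h3 hrp
          · exact hA

/-! ### The run -/

/-- **Soundness of a run** along the table cursor. [folklore] -/
theorem run_sound : ∀ (fuel : ℕ) {s s' : AS}, Inv s → run fuel s (after s.p table) = some s' →
    Inv s'
  | 0, s, s', hI, h => by
      simp only [run, Option.some.injEq] at h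
      exact h ▸ hI
  | fuel + 1, s, s', hI, h => by
      rcases hseg : after s.p table with _ | ⟨p', rest⟩
      · rw [hseg] at h
        simp only [run, Option.some.injEq] at h
        exact h ▸ hI
      · rw [hseg] at h
        simp only [run] at h
        rcases hst : step s p' with _ | s₁
        · rw [hst] at h; simp at h
        · rw [hst] at h
          simp only at h
          obtain ⟨hI₁, hp₁⟩ := step_inv hI hseg hst
          have hrest : rest = after s₁.p table := by
            rw [hp₁]; exact tail_after tableOK.sorted hseg
          rw [hrest] at h
          exact run_sound fuel hI₁ h

/-- **Soundness of a chunk**: `runD` preserves the invariant. [folklore] -/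
theorem runD_sound {fuel : ℕ} {s s' : AS} (hI : Inv s) (h : runD fuel s = some s') : Inv s' :=
  run_sound fuel hI h

/-! ### The initial state and the conclusions -/

/-- **The initial state satisfies the invariant.** [folklore] -/
theorem initS_inv : Inv initS := by
  have hl2 := Real.log_two_gt_d9
  have hl2' := Real.log_two_lt_d9
  obtain ⟨hF2, hC2⟩ := F_two
  refine ⟨tableOK.two_mem, Nat.prime_two, ?_, ?_, ?_, ?_, ?_, ?_, ?_, ?_⟩
  · simpa [initS] using L2LON_le
  · simpa [initS] using le_L2HIN
  · simp only [initS]; rw [hF2]; exact le_L2HIN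
  · simp only [initS, Nat.add_eq, natDiv_eq]
    push_cast
    rw [hC2]
    have hd := real_div_le_natDiv_add_one L2HIN (b := 2) (by norm_num)
    have h2 := le_L2HIN
    push_cast at hd
    linarith
  · simp only [initS]; push_cast; rw [theta_two]; exact L2LON_le
  · simp only [initS]; push_cast; rw [theta_two]; exact le_L2HIN
  · simp only [initS]
    push_cast
    rw [theta_two]
    -- `0 ≤ log log 2 + 1`: `log 2 > e⁻¹`
    have he := Real.exp_one_lt_d9
    have hinv : Real.exp (-1) < Real.log 2 := by
      rw [Real.exp_neg]
      have : (1 : ℝ) / Real.exp 1 < 0.37 := by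
        rw [div_lt_iff₀ (Real.exp_pos 1)]
        linarith [Real.exp_one_gt_d9]
      rw [inv_eq_one_div]
      linarith
    have : -1 ≤ Real.log (Real.log 2) := by
      rw [Real.le_log_iff_exp_le (by linarith)]
      exact hinv.le
    linarith
  · intro r hr h3 hr2
    simp only [initS] at hr2
    omega

/-- **(A) from a finished run**: the invariant at a state with prime `P` gives
`F(r) < log θ(r) + 0.66` for every prime `3 ≤ r ≤ P`. [cite: Khale2024, Corollary A.2] -/
theorem F_lt_of_inv {s : AS} (hI : Inv s) {r : ℕ} (hr : r.Prime) (h3 : 3 ≤ r) (hrP : r ≤ s.p) :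
    F r < Real.log (θ (r : ℝ)) + 0.66 :=
  hI.claim r hr h3 hrP

/-- **The export of the final test**: `finalChk s` and the invariant give `10⁶ ≤ s.p` and
`C(s.p) ≤ 0.7555`. [folklore] -/
theorem C_le_of_finalChk {s : AS} (hI : Inv s) (h : finalChk s = true) :
    1000000 ≤ s.p ∧ C s.p ≤ 0.7555 := by
  simp only [finalChk, Bool.and_eq_true, Nat.ble_eq] at h
  obtain ⟨h1, h2⟩ := h
  refine ⟨h1, ?_⟩
  have h2R : (s.Chi : ℝ) ≤ CMAX := by exact_mod_cast h2
  have h3 := hI.C_le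
  have h4 := CMAX_le
  linarith

end Literature.NumberTheory.LFunctions.KhaleChain
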